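import Summits.Ventures.PercRepro.C026CHubB

/-!
# C-026 when the neighbourhood of `c` is hub-like (p5, gen 9; mine-3's Theorem′)

**Theorem** (`c026_cHub`): C-026 holds at every `p ∈ [0,1]^E` on every marked multigraph in which
every non-mark neighbour of `c` is adjacent only to the marks `a, b, c` — p1's family
`IsMarkHubGraph a b c c` (`C026HubFamilyExt.lean`); the rest of the graph is arbitrary.  It
contains the hub theorem `c026_hub` (`IsHubGraph.isMarkHubGraph`).

Proof.  p1's family induction (`c026_cHub_of_reduced`: minors, loops, parallel pairs, `a–b` edges,
repeated marks) reduces the statement to the **reduced class positivity** on the family — on a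
SIMPLE member with distinct marks, `#Bot₃ ≤ #(ac|b) + #(bc|a)` (`cubeSumQuad_kernel26_nonneg_iff`).
By `bot3_iff'` (`C026CHubA.lean`) a `bot` configuration is in `Bot₃` iff Case 1 or (`a ~ c` and
`c ~ b`), so the three maps of `C026HubC.lean` apply unchanged: `phi1` opens the `a`-edge of a
double hub of `M` (image in `ac|b`), the `bc`-edge is opened when it exists (image in `bc|a`), and
otherwise `phi3` opens the `c`- and `b`-edges of an isolated hub (image in `bc|a`).  With the
clusters `K`, `L` of `a`, `b` arbitrary the images are placed by the contraction lemma
`conn_update_true_iff` (opening one edge between two clusters merges exactly those two), and the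
decoders `closeA`, «close the `bc`-edge», `closeBC` are the ones of `C026HubC.lean`
(`closeA_phi1`, `update_bc_inv`, `closeBC_phi3`, which only use `bot`).
-/

namespace PercRepro

open Finset

namespace MultiGraph

variable {V E : Type*} {G : MultiGraph V E}

/-! ### The images of the three maps, with `K` and `L` arbitrary -/

section Images

variable {a b c : V} {ω : Config E}

/-- In `bot`, opening one edge between the cluster of `c` and the cluster of `a` keeps `a ≁ b`. -/
theorem IsBot.not_conn_ab_update_of_conn_c [DecidableEq E] (hbot : G.IsBot ω a b c) {e : E}
    {h : V} (hl : G.Link e h a) (hc : G.Conn ω c h) :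
    ¬ G.Conn (Function.update ω e true) a b := by
  rw [conn_update_true_iff]
  rintro (h' | ⟨-, h2⟩ | ⟨-, h2⟩)
  · exact hbot.1 h'
  · rcases hl with ⟨-, hs⟩ | ⟨-, hs⟩
    · rw [hs] at h2
      exact hbot.1 h2
    · rw [hs] at h2
      exact hbot.2.2 (hc.trans h2).symm
  · rcases hl with ⟨hf, -⟩ | ⟨hf, -⟩
    · rw [hf] at h2
      exact hbot.2.2 (hc.trans h2).symm
    · rw [hf] at h2
      exact hbot.1 h2

/-- The Case-1 image lies in `ac|b` (the neighbourhood of `c` hub-like). -/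
theorem phi1_mem' [DecidableEq E] {ω : Config E} (hbot : G.IsBot ω a b c)
    (h1 : G.Case1 ω a b c) :
    G.Conn (G.phi1 a b c ω) a c ∧ ¬ G.Conn (G.phi1 a b c ω) a b := by
  obtain ⟨-, hc, hl, -⟩ := case1Hub_spec h1
  unfold phi1
  rw [dif_pos h1]
  constructor
  · have h1' : G.Conn (Function.update ω (G.case1Edge h1) true) (G.case1Hub h1) a :=
      hl.conn (Function.update_self ..)
    exact h1'.symm.trans hc.conn.update_true
  · exact hbot.not_conn_ab_update_of_conn_c hl hc.conn.symm

/-- The Case-2 image with a `bc`-edge lies in `bc|a`. -/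
theorem phi2_mem' [DecidableEq E] {ω : Config E} (hbot : G.IsBot ω a b c) {e₀ : E}
    (hl : G.Link e₀ b c) :
    G.Conn (Function.update ω e₀ true) b c ∧ ¬ G.Conn (Function.update ω e₀ true) a b := by
  constructor
  · exact hl.conn (Function.update_self ..)
  · rw [conn_update_true_iff]
    rintro (h' | ⟨h1, h2⟩ | ⟨h1, h2⟩)
    · exact hbot.1 h'
    · rcases hl with ⟨hf, hs⟩ | ⟨hf, hs⟩
      · rw [hf] at h1
        exact hbot.1 h1
      · rw [hf] at h1
        exact hbot.2.1 h1
    · rcases hl with ⟨hf, hs⟩ | ⟨hf, hs⟩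
      · rw [hs] at h1
        exact hbot.2.1 h1
      · rw [hs] at h1
        exact hbot.1 h1

/-- The Case-2 image without a `bc`-edge lies in `bc|a` whenever the chosen isolated hub is
hub-like (so that its cluster is a singleton). -/
theorem phi3_mem_of_isHubLike [DecidableEq E] (hbc : b ≠ c) {ω : Config E}
    (hbot : G.IsBot ω a b c) (h2 : G.Case2Iso ω a b c)
    (hhub : G.IsHubLike a b c (G.case2Hub h2)) :
    G.Conn (G.phi3 a b c ω) b c ∧ ¬ G.Conn (G.phi3 a b c ω) a b := by
  obtain ⟨hh, hno, hlc, hlb⟩ := case2Hub_spec h2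
  have hne := G.case2EdgeC_ne hbc h2
  -- the isolated hub is connected to nothing else in `ω`
  have hiso : ∀ y, G.Conn ω (G.case2Hub h2) y → y = G.case2Hub h2 := fun y hy =>
    hhub.eq_of_conn_of_noOpen hno hy
  have har : ¬ G.Conn ω a (G.case2Hub h2) := fun h => hh.1 (hiso a h.symm).symm
  set r := G.case2Hub h2 with hr
  set ec := G.case2EdgeC h2 with hec
  set eb := G.case2EdgeB h2 with heb
  set ω' := Function.update ω ec true with hω'
  unfold phi3
  rw [dif_pos h2, ← hec, ← heb, ← hω']
  -- after opening `r–c`: `a ≁ b`, `a ≁ r` (the cluster of `a` is untouched)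
  have hab' : ¬ G.Conn ω' a b := by
    rw [hω', conn_update_true_iff]
    rintro (h' | ⟨h1, h2'⟩ | ⟨h1, h2'⟩)
    · exact hbot.1 h'
    · rcases hlc with ⟨hf, hs⟩ | ⟨hf, hs⟩
      · rw [hf] at h1
        exact har h1
      · rw [hf] at h1
        exact hbot.2.1 h1
    · rcases hlc with ⟨hf, hs⟩ | ⟨hf, hs⟩
      · rw [hs] at h1
        exact hbot.2.1 h1
      · rw [hs] at h1
        exact har h1
  have har' : ¬ G.Conn ω' a r := by
    rw [hω', conn_update_true_iff]
    rintro (h' | ⟨h1, h2'⟩ | ⟨h1, h2'⟩)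
    · exact har h'
    · rcases hlc with ⟨hf, hs⟩ | ⟨hf, hs⟩
      · rw [hf] at h1
        exact har h1
      · rw [hf] at h1
        exact hbot.2.1 h1
    · rcases hlc with ⟨hf, hs⟩ | ⟨hf, hs⟩
      · rw [hs] at h1
        exact hbot.2.1 h1
      · rw [hs] at h1
        exact har h1
  constructor
  · have h1 : G.Conn (Function.update ω' eb true) r b := hlb.conn (Function.update_self ..)
    have h2' : G.Conn (Function.update ω' eb true) r c :=
      hlc.conn (by rw [Function.update_of_ne hne, hω', Function.update_self])
    exact h1.symm.trans h2'
  · rw [conn_update_true_iff]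
    rintro (h' | ⟨h1, h2'⟩ | ⟨h1, h2'⟩)
    · exact hab' h'
    · rcases hlb with ⟨hf, hs⟩ | ⟨hf, hs⟩
      · rw [hf] at h1
        exact har' h1
      · rw [hf] at h1
        exact hab' h1
    · rcases hlb with ⟨hf, hs⟩ | ⟨hf, hs⟩
      · rw [hs] at h1
        exact hab' h1
      · rw [hs] at h1
        exact har' h1

/-- The Case-2 image without a `bc`-edge lies in `bc|a` (the neighbourhood of `c` hub-like). -/
theorem phi3_mem' [DecidableEq E] (hG : G.IsMarkHubGraph a b c c) (hbc : b ≠ c) {ω : Config E}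
    (hbot : G.IsBot ω a b c) (h2 : G.Case2Iso ω a b c) :
    G.Conn (G.phi3 a b c ω) b c ∧ ¬ G.Conn (G.phi3 a b c ω) a b :=
  G.phi3_mem_of_isHubLike hbc hbot h2
    (hG.isHubLike_of_link (case2Hub_spec h2).1 (case2Hub_spec h2).2.2.1)

end Images

/-! ### The class lemma on the family -/

open Classical in
/-- **`#Bot₃ ≤ #(ac|b) + #(bc|a)` on a simple graph with distinct marks whose neighbourhood of `c`
is hub-like**: Case 1 injects into `ac|b`, Case 2 into `bc|a`. -/
theorem IsMarkHubGraph.bot3_card_le {a b c : V} [Fintype E] [DecidableEq E]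
    (hG : G.IsMarkHubGraph a b c c) (hs : G.IsSimple) (hab : a ≠ b) (hac : a ≠ c) (hbc : b ≠ c) :
    (Finset.univ.filter fun ω : Config E => G.Bot3 ω a b c).card ≤
      (Finset.univ.filter fun ω : Config E => G.Conn ω a c ∧ ¬ G.Conn ω a b).card +
        (Finset.univ.filter fun ω : Config E => G.Conn ω b c ∧ ¬ G.Conn ω a b).card := by
  set S := Finset.univ.filter fun ω : Config E => G.Bot3 ω a b c with hS
  have hsplit := Finset.card_filter_add_card_filter_not (s := S) (p := fun ω => G.Case1 ω a b c)
  have hmem : ∀ ω ∈ S, G.IsBot ω a b c ∧ (G.Case1 ω a b c ∨ (G.AtoC ω a b c ∧ G.CtoB ω a b c)) :=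
    fun ω hω => (bot3_iff' hG hs hab hac hbc).1 (Finset.mem_filter.1 hω).2
  have h1 : (S.filter fun ω => G.Case1 ω a b c).card ≤
      (Finset.univ.filter fun ω : Config E => G.Conn ω a c ∧ ¬ G.Conn ω a b).card := by
    refine Finset.card_le_card_of_injOn (G.phi1 a b c) (fun ω hω => ?_) (fun ω hω ω' hω' heq => ?_)
    · obtain ⟨hω, hc⟩ := Finset.mem_filter.1 hω
      exact Finset.mem_filter.2 ⟨Finset.mem_univ _, G.phi1_mem' (hmem ω hω).1 hc⟩
    · obtain ⟨hω, hc⟩ := Finset.mem_filter.1 hω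
      obtain ⟨hω', hc'⟩ := Finset.mem_filter.1 hω'
      rw [← closeA_phi1 hac (hmem ω hω).1 hc, ← closeA_phi1 hac (hmem ω' hω').1 hc', heq]
  have h2 : (S.filter fun ω => ¬ G.Case1 ω a b c).card ≤
      (Finset.univ.filter fun ω : Config E => G.Conn ω b c ∧ ¬ G.Conn ω a b).card := by
    by_cases hbc' : G.HasEdge b c
    · obtain ⟨e₀, hl⟩ := hbc'
      refine Finset.card_le_card_of_injOn (fun ω => Function.update ω e₀ true)
        (fun ω hω => ?_) (fun ω hω ω' hω' heq => ?_)
      · obtain ⟨hω, -⟩ := Finset.mem_filter.1 hω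
        exact Finset.mem_filter.2 ⟨Finset.mem_univ _, G.phi2_mem' (hmem ω hω).1 hl⟩
      · obtain ⟨hω, -⟩ := Finset.mem_filter.1 hω
        obtain ⟨hω', -⟩ := Finset.mem_filter.1 hω'
        have heq' : Function.update ω e₀ true = Function.update ω' e₀ true := heq
        rw [← update_bc_inv hbc (hmem ω hω).1 hl, ← update_bc_inv hbc (hmem ω' hω').1 hl, heq']
    · have hiso : ∀ ω ∈ S, ¬ G.Case1 ω a b c → G.Case2Iso ω a b c := by
        intro ω hω hc
        rcases (hmem ω hω).2 with h | ⟨-, h | h⟩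
        · exact absurd h hc
        · exact absurd h hbc'
        · exact h
      refine Finset.card_le_card_of_injOn (G.phi3 a b c) (fun ω hω => ?_)
        (fun ω hω ω' hω' heq => ?_)
      · obtain ⟨hω, hc⟩ := Finset.mem_filter.1 hω
        exact Finset.mem_filter.2 ⟨Finset.mem_univ _,
          G.phi3_mem' hG hbc (hmem ω hω).1 (hiso ω hω hc)⟩
      · obtain ⟨hω, hc⟩ := Finset.mem_filter.1 hω
        obtain ⟨hω', hc'⟩ := Finset.mem_filter.1 hω'
        rw [← closeBC_phi3 hbc (hmem ω hω).1 (hiso ω hω hc),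
          ← closeBC_phi3 hbc (hmem ω' hω').1 (hiso ω' hω' hc'), heq]
  calc S.card = (S.filter fun ω => G.Case1 ω a b c).card +
        (S.filter fun ω => ¬ G.Case1 ω a b c).card := hsplit.symm
    _ ≤ _ := add_le_add h1 h2

/-- **Class positivity of `kernel26` on a simple graph with distinct marks whose neighbourhood of
`c` is hub-like.** -/
theorem IsMarkHubGraph.cubeSumQuad_nonneg_of_simple {a b c : V} [Fintype E] [DecidableEq E]
    (hG : G.IsMarkHubGraph a b c c) (hs : G.IsSimple) (hab : a ≠ b) (hac : a ≠ c) (hbc : b ≠ c) :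
    0 ≤ G.cubeSumQuad ![a, b, c] kernel26 := by
  classical
  rw [G.cubeSumQuad_kernel26_nonneg_iff]
  exact hG.bot3_card_le hs hab hac hbc

/-- A hub graph is in the family: every non-mark is adjacent only to marks. -/
theorem IsHubGraph.isMarkHubGraph {a b c : V} (hG : G.IsHubGraph a b c) :
    G.IsMarkHubGraph a b c c := by
  have hub : ∀ x, ¬ IsMark a b c x → G.IsHubLike a b c x := by
    intro x hx f
    constructor
    · intro hf
      rcases hG f with h | h
      · exact absurd (by rw [← hf]; exact h) hx
      · exact h
    · intro hf
      rcases hG f with h | h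
      · exact h
      · exact absurd (by rw [← hf]; exact h) hx
  intro f
  exact ⟨fun _ hx => hub _ hx, fun _ hx => hub _ hx⟩

end MultiGraph

/-! ### The theorem -/

/-- **The reduced class positivity on the family «the neighbourhood of `c` is hub-like»** — the
hypothesis of p1's `c026_cHub_of_reduced` (the `a–b`-edge hypothesis is not needed: an `a–b` edge is
closed in `bot` and untouched by the three maps). -/
theorem cHubFamily_reducedClassPositive : cHubFamily.ReducedClassPositive := by
  intro V E _ _ _ G a b c hG hs hab hac hbc _
  exact MultiGraph.IsMarkHubGraph.cubeSumQuad_nonneg_of_simple hG hs hab hac hbc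

/-- **C-026 when the neighbourhood of `c` is hub-like** (mine-3's Theorem′): for every marked
multigraph in which every non-mark neighbour of `c` is adjacent only to the marks (the rest of the
graph arbitrary), every `p ∈ [0,1]^E`: `(x + y₁)(y₁ + z) ≤ y₁ + y₂ + y₃`, i.e.
`P(a~b)·P(c ≁ {a,b}) ≤ P(one pair)`. -/
theorem c026_cHub {V E : Type} [Fintype V] [Fintype E] [DecidableEq E] (G : MultiGraph V E)
    {a b c : V} (hG : G.IsMarkHubGraph a b c c) (p : E → ℝ) (hp : IsProb p) :
    (G.law3 p a b c 0 + G.law3 p a b c 1) * (G.law3 p a b c 1 + G.law3 p a b c 4) ≤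
      G.law3 p a b c 1 + G.law3 p a b c 2 + G.law3 p a b c 3 :=
  c026_cHub_of_reduced cHubFamily_reducedClassPositive G hG p hp

/-- The hub theorem `c026_hub` as the special case of `c026_cHub` in which every non-mark is
hub-like (a second proof, through p1's family induction). -/
theorem c026_hub' {V E : Type} [Fintype V] [Fintype E] [DecidableEq E] (G : MultiGraph V E)
    {a b c : V} (hG : G.IsHubGraph a b c) (p : E → ℝ) (hp : IsProb p) :
    (G.law3 p a b c 0 + G.law3 p a b c 1) * (G.law3 p a b c 1 + G.law3 p a b c 4) ≤
      G.law3 p a b c 1 + G.law3 p a b c 2 + G.law3 p a b c 3 :=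
  c026_cHub G hG.isMarkHubGraph p hp

end PercRepro
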